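import Summits.BirchSwinnertonDyer.BirchSwinnertonDyer.Theses.UniversalToricDescent
import Summits.BirchSwinnertonDyer.BirchSwinnertonDyer.Theorems.UniversalToricDescentTwinAlgMuZeroAtThreeOfBetaRoadParam
import Summits.BirchSwinnertonDyer.BirchSwinnertonDyer.Theorems.UniversalToricDescentBetaRoadParamDefs

/-!
# Line `beta-road` on `UniversalToricDescent.TwinAlgMuZeroAtThree` (stmt-BirchSwinnertonDyer-24737, crux r205, R2 text)
# — REGISTERED skeleton, v19 (LEAD `bsd-wall-utd-p1` g34, 2026-08-30)

**v19 — THE CRUX'S MODULAR-PARAMETRISATION BINDER `Dt′` THREADED TO THE STUBS (count-neutral 3 = 3; the stub set is WEAKENED).**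
v18 (sha16 `36c96564301e5a48`, g30) = three stubs BY NAME (K1″ p771182 · K2a‴ item 32864 · C₀ p774065) + the one-line `TwinAlgMuZeroAtThree_of`
through the landed composition p771272.  LEAD g34 audit: the crux `TwinAlgMuZeroAtThree` hands over `(Dt' : ModularParametrizationData W' N')`
(Modularity + uniformisation + integral Manin constant AS DATA = the named fact `nonempty_modularParametrizationData`, BCDT Thm. A), but the
v16/v18 composition discards it (`intro … Dt' …` unused; vet flag `ground.unused-binder Dt'`) while K1″ concludes `∃ (Dt : ModularParametrizationData
W' N') …` from arithmetic binders alone — so ANY proof of K1″ must first prove Modularity-as-data for every bucket-B twin (a conditional result at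
best) — and C₀ is the R2 bucket MINUS `Dt'` (same defect for the signed-frame proof, which starts from the newform `Dt'.f`).  v19 repairs this and
nothing else: K1‴ / C₀′ = the v18 texts with the binder `Dt'` inserted at the crux's position (constants of `…Theorems.UniversalToricDescentBetaRoadParamDefs`),
K1″ → K1‴ and C₀ → C₀′ are tree theorems, and `TwinAlgMuZeroAtThree_of` passes the crux's `Dt'` through the landed `Dt'`-threaded composition
`…Theorems.UniversalToricDescentTwinAlgMuZeroAtThreeOfBetaRoadParam.twinAlgMuZeroAtThree_of_betaRoadParamStubs` (sorry-free: K1‴ → K2a‴ → C₀′ → crux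
BY NAME; its `…_of_betaRoadStubs_v18` records that the v18 stubs still suffice).  The three research inputs, all BY NAME:
* `stub_principalHeegnerIndivisibleMult : UniversalToricDescentBetaRoadParamDefs.PrincipalHeegnerIndivisibleMultOfParamAtThree` (K1‴; RESEARCH,
  instrument-decidable per instance; ⇐ K1″ p771182);
* `stub_ksTwinLambda : …Theses.UniversalToricDescent.KsTwinLambdaAdicAtThree` (K2a‴ = UTD item stmt-BirchSwinnertonDyer-32864, aside r207; unfolds to
  `UniversalToricDescentKsTwinLambdaDefs.KsTwinLambdaAdicAtThree`, p770265; RESEARCH, unprinted at `p ∣ N`; UNCHANGED — its `HeegnerFamily` binder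
  already carries a parametrisation);
* `stub_goodSS : UniversalToricDescentBetaRoadParamDefs.TwinAlgMuZeroAtThreeGoodSSOfParam` (C₀′ = the good-supersingular `a₃ = 0` bucket of R2 now
  binder-for-binder; RESEARCH, signed frame — a different line, planners; ⇐ C₀ p774065).
Fallbacks: v18 = `Cruxes/TwinAlgMuZeroAtThree/Lines/beta_road.lean`@4fc7e8d06bb1 = `HOME/bsd-wall-utd-p1/beta-road-v18-24737-utdp1g30.lean`; v17/v16 see v18's banner.
`TwinAlgMuZeroAtThree_of` concludes the crux BY NAME.  BSD is proved for no curve by this file; 24737 / 32864 stay OPEN.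
-/

noncomputable section

open scoped Classical NumberField

set_option linter.dupNamespace false
set_option autoImplicit false

namespace Summit.BirchSwinnertonDyer.BirchSwinnertonDyer.Cruxes.TwinAlgMuZeroAtThree.BetaRoad

open NumberField IsDedekindDomain Field WeierstrassCurve
open Literature.NumberTheory.EllipticCurves Literature.NumberTheory.EllipticCurves.IwasawaAlgebra
open Summit.BirchSwinnertonDyer.Rank1Residual.X11b Summit.BirchSwinnertonDyer.Rank1Residual.X11b.AcSelmer
open Summit.BirchSwinnertonDyer.BirchSwinnertonDyer.Theorems
open Literature.NumberTheory.EllipticCurves.ZpExtension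

/-! ## 1. The stubs -/

/-- **stub_principalHeegnerIndivisibleMult** (K1‴, RESEARCH, instrument-decidable per instance) — BY NAME: the Theorems constant
`UniversalToricDescentBetaRoadParamDefs.PrincipalHeegnerIndivisibleMultOfParamAtThree` = the v16/v18 K1″ text with the crux's binder
`(Dt' : ModularParametrizationData W' N')` inserted («on bucket B, GIVEN a modular parametrisation datum `Dt′`, at every degree-one `𝔭 ∋ 3`, for some
`jbar Dt β k x R`, the principal Heegner norm point `∑_{r∈R} r • x` of conductor `3^{k+1}` over `K_k` is not `3 • P` for any `P` fixed by `Γ_{K_k} ⊓ D_𝔭`»;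
readback `principalHeegnerIndivisibleMultOfParamAtThree_iff`; implied by K1″ p771182).
[cite: Castella2024, §2.2 and Thm. 2.1] [cite: BertoliniDarmon1996, §2.5] -/
theorem stub_principalHeegnerIndivisibleMult :
    UniversalToricDescentBetaRoadParamDefs.PrincipalHeegnerIndivisibleMultOfParamAtThree := by
  sorry

/-- **stub_ksTwinLambda** (K2a‴, RESEARCH, unprinted at `p ∣ N`; UNCHANGED from v17/v18) — BY NAME = THE PROMOTED UTD ITEM stmt-BirchSwinnertonDyer-32864
`…Theses.UniversalToricDescent.KsTwinLambdaAdicAtThree` (aside r207), which unfolds to the Theorems constant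
`UniversalToricDescentKsTwinLambdaDefs.KsTwinLambdaAdicAtThree` (p770265) (ONE `Λ`-adic Heegner-point Kolyvagin system on lit's `shapiroSettingTame`
with bottom class `Φ′(𝐳_∞)`; readback `ksTwinLambdaAdicAtThree_iff`).
[cite: Howard2004HeegnerKolyvagin, Thm. 2.3.1] [cite: CastellaGrossiLeeSkinner2022, Thm. 4.1.1, Rem. 4.1.4] -/
theorem stub_ksTwinLambda :
    Summit.BirchSwinnertonDyer.BirchSwinnertonDyer.Theses.UniversalToricDescent.KsTwinLambdaAdicAtThree := by
  sorry

/-- **stub_goodSS** (C₀′, RESEARCH, signed frame — a different line; planners) — BY NAME: the Theorems constant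
`UniversalToricDescentBetaRoadParamDefs.TwinAlgMuZeroAtThreeGoodSSOfParam` = the v1–v18 C₀ text with the crux's binder `(Dt' : ModularParametrizationData W' N')`
inserted (= the good-supersingular `a₃ = 0` bucket of the R2 text binder-for-binder; readback `twinAlgMuZeroAtThreeGoodSSOfParam_iff`; implied by C₀ p774065).
[cite: BurungaleCastellaSkinner2025, Thm. 4.2.1 (b), Prop. 4.2.2 (shape only, p ∤ N there)] -/
theorem stub_goodSS :
    UniversalToricDescentBetaRoadParamDefs.TwinAlgMuZeroAtThreeGoodSSOfParam := by
  sorry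

/-! ## 2. The composition (a tree theorem) -/

/-- **The composition**: `UniversalToricDescentTwinAlgMuZeroAtThreeOfBetaRoadParam.twinAlgMuZeroAtThree_of_betaRoadParamStubs` (sorry-free; passes the
crux's own `Dt'` to K1‴ and C₀′) applied to the three stubs (K2a‴ unfolded from the route item's name).  Concludes the crux BY NAME. -/
theorem TwinAlgMuZeroAtThree_of :
    Summit.BirchSwinnertonDyer.BirchSwinnertonDyer.Theses.UniversalToricDescent.TwinAlgMuZeroAtThree :=
  UniversalToricDescentTwinAlgMuZeroAtThreeOfBetaRoadParam.twinAlgMuZeroAtThree_of_betaRoadParamStubs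
    stub_principalHeegnerIndivisibleMult
    -- the route item `…Theses.UniversalToricDescent.KsTwinLambdaAdicAtThree` (stmt-32864) unfolds to the Theorems constant
    (by simpa only [Summit.BirchSwinnertonDyer.BirchSwinnertonDyer.Theses.UniversalToricDescent.KsTwinLambdaAdicAtThree]
      using stub_ksTwinLambda)
    stub_goodSS

end Summit.BirchSwinnertonDyer.BirchSwinnertonDyer.Cruxes.TwinAlgMuZeroAtThree.BetaRoad

end
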